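import Summits.RiemannHypothesis.RiemannHypothesis.Theorems.MotivicDoorCertPosGramPacked
import Summits.RiemannHypothesis.RiemannHypothesis.Theorems.MotivicDoorCertPosX13N100EvenPart1
import Summits.RiemannHypothesis.RiemannHypothesis.Theorems.MotivicDoorCertPosX13N100EvenDataC0a
import Summits.RiemannHypothesis.RiemannHypothesis.Theorems.MotivicDoorCertPosX13N100EvenDataC0b
import Summits.RiemannHypothesis.RiemannHypothesis.Theorems.MotivicDoorCertPosX13N100EvenDataC1a
import Summits.RiemannHypothesis.RiemannHypothesis.Theorems.MotivicDoorCertPosX13N100EvenDataC1b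
import Summits.RiemannHypothesis.RiemannHypothesis.Theorems.MotivicDoorCertPosX13N100EvenDataC2a
import Summits.RiemannHypothesis.RiemannHypothesis.Theorems.MotivicDoorCertPosX13N100EvenDataC2b
import Summits.RiemannHypothesis.RiemannHypothesis.Theorems.MotivicDoorCertPosX13N100EvenDataC3
import Summits.RiemannHypothesis.RiemannHypothesis.Theorems.MotivicDoorCertPosX13N100EvenDataL0a
import Summits.RiemannHypothesis.RiemannHypothesis.Theorems.MotivicDoorCertPosX13N100EvenDataL0b
import Summits.RiemannHypothesis.RiemannHypothesis.Theorems.MotivicDoorCertPosX13N100EvenDataL1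
import Summits.RiemannHypothesis.RiemannHypothesis.Theorems.MotivicDoorCertPosGramUpperRows
import HarnessLib

/-!
# Motivic door / CERTPOS cell `x13N100Even` — certified `ε₁` enclosure of a truncated Weil-form block — PART 2 (row shards 6–7)

pub-rhdoor (MOTIVIC-DOOR ticket), unit `certpos`; schema `rhdoor.certpos/1`. HONEST FRAMING: lottery ticket at the motivic
door; RH probability negligible; this file is a DATA-conditioned certificate about ONE finite window matrix — no RH claim,
no claim about `N → ∞` or about other windows.

CELL: a = log 13 / 2 (L = 2a = log 13, the x = 13 window of [CCM2025]/[Connes2026]); S = all places (the zeta weights Λ(q) q^{-1/2} on every prime power q ≤ e^L); even sector, test space V_N^+ of dimension N + 1 = 101 (PfPersistence.evenBlock).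

* DATA (hypothesis `hG : x13N100Even.Encloses G`, NOT proved here): every entry of the tree matrix `G = zetaDatum x13N100EvenWin` lies in the ball
  `C i j / 2^234 ± r i j / 2^234` of the certificate. Produced off-line by TWO independent interval engines whose entrywise balls
  overlap (max hull width 1.9833566456403087e-119, max midpoint difference 1.2352715533560994e-127; the Lean data is the hull re-rounded outward to scale 2^234):
  * eng1_arb/wa_core (python-flint Arb), 432 bits, wa_core sha256 661b62ee9ab2476f…
  * eng2_iv/EM-digamma (mpmath.iv mpmath.ctx_mp), 432 bits
  Source certificate digest (sha256 over k,t,u,mn,bn,Cn,rn,Ln): `f23464b8a9b0338f549e1ab3bb5c0f0e0fef3a599caac4a97cb4fef07ea69823`; re-rounded digest `dc13eeefcedeaa92526eba9c891252f2631b02136e31aeea08be30d468d838b3`.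
* PROVED (kernel, `decide +kernel`, 11 row shards): the integer check `GramCert.Valid` (LDLᵀ residual budget) and the
  upper witness check `GramCert.upperOK`; hence, GIVEN the data hypothesis,
  `margin ≤ ε₁(G) ≤ num/den` with  margin = 3.72089974056594937945361746251e-59  and  num/den = 3.72089974168300188848780304459e-59
  (relative gap 3.00e-10). In particular `0 < ε₁(G)`: the block is POSITIVE DEFINITE (given the data).
-/

set_option linter.dupNamespace false
set_option exponentiation.threshold 4096

namespace Summit.RiemannHypothesis.RiemannHypothesis.Theorems.MotivicDoor.CertPos

open Summit.RiemannHypothesis.RiemannHypothesis.Theorems.PfPersistence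

set_option maxHeartbeats 0 in
/-- PROVED (kernel): row shard 6 (rows 60 ≤ i < 70) of the check passes. [folklore] -/
theorem x13N100Even_rows_6 : x13N100Even.rowsOK (10 * 6) 10 = true := by decide +kernel

set_option maxHeartbeats 0 in
/-- PROVED (kernel): row shard 7 (rows 70 ≤ i < 80) of the check passes. [folklore] -/
theorem x13N100Even_rows_7 : x13N100Even.rowsOK (10 * 7) 10 = true := by decide +kernel

end Summit.RiemannHypothesis.RiemannHypothesis.Theorems.MotivicDoor.CertPos

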